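import Mathlib
import HarnessLib
import Literature.Probability.Percolation.MinOpenCut
import Literature.Probability.Percolation.Crossings
import Literature.Probability.Percolation.PlanarDuality
import Summits.CriticalPhenomena.PercolationContinuityZ3.Theses.PercBudgetLadder
import Summits.CriticalPhenomena.PercolationContinuityZ3.Theses.PercNonProliferation
import Summits.CriticalPhenomena.PercolationContinuityZ3.Theorems.PercBudgetLadderBudgetTightnessAspectTwo

/-!
# Crux `BudgetTightness` (stmt-CriticalPhenomena-5248): the split in ANNULUS coordinates —
# `NonProliferation (stmt-CriticalPhenomena-4444) → (per-cluster throughput tight) → BudgetTightness`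

Landed form (def-free, statements verbatim over tree declarations) of the crux-strategist's kernel-checked
census artefact `Cruxes/BudgetTightness/AnnulusSplit_s1.lean` (planner-cstrat s1, `STRATEGY-CENSUS.md`
§Decomposition, item D2), landed by the line lead c10 as a `--supports` helper so that the recorded split is
importable: the COUNT half is VERBATIM the existing crux `PercNonProliferation.NonProliferation`
(stmt-CriticalPhenomena-4444; necessary for `BudgetTightness` by the landed
`NonProliferation.nonProliferation_of_budgetTightness_two`), the THROUGHPUT half says that, uniformly in `n`,
with high probability no open cluster of `B(2n)` carries more than `K` edge-disjoint open crossings of the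
annulus `B(n) → ∂ⁱⁿB(2n)` (its i.o. weakening is necessary for the crux by `budgetTightness_iff_tight_two`;
it is FALSE for `p > p_c`, where the giant carries `≍ n²` crossings).

Notation (inlined everywhere): region `R = ↑(box 3 (2n))`, target `T = ↑(innerBoundary (zdGraph 3) (box 3 (2n)))`,
and the THROUGHPUT of the cluster of `x` across the annulus,
`minOpenCutIn R {a | a ∈ box 3 n ∧ ω ∈ openConnIn R x a} T ω : ℕ∞`
(the min-cut from the part of `x`'s open cluster inside `B(n)` to `∂ⁱⁿB(2n)`, inside `B(2n)`; `0` when the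
cluster of `x` does not cross).

* `AnnulusSplit.minCut_le_of_reps_of_throughput` (pointwise): if `B(n)` contains no `M+1` pairwise-unjoined
  crossing representatives (the complement of stmt-4444's event) and every cluster throughput is `≤ K`, then
  `MinCut(n,2n) ≤ M·K` — a maximal pairwise-unjoined family of crossing representatives has `≤ M` members
  and meets the cluster of every crossing vertex; the union of the representatives' `≤ K`-cutsets destroys
  every crossing because `{a ↔ b in S}` is increasing in the configuration.
* `budgetTightness_of_nonProliferation_of_throughputTight`: `NonProliferation → (throughput tight) →
  BudgetTightness` with `k = M·K`, `l = 2`, constant `c/2` (`frequently ∧ eventually`, union bound).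
-/

noncomputable section

namespace Summit.CriticalPhenomena.PercolationContinuityZ3.Theorems.BudgetTightness

open MeasureTheory Filter Topology
open Literature.Probability.Percolation Literature.Probability.LatticeModels
open Summit.CriticalPhenomena.PercolationContinuityZ3.Theses.PercBudgetLadder (BudgetTightness)
open Summit.CriticalPhenomena.PercolationContinuityZ3.Theses.PercNonProliferation (NonProliferation)

namespace AnnulusSplit

/-- **Pointwise: `MinCut ≤ (#crossing clusters) · (max throughput)`.** If `B(n)` contains no `M+1`
pairwise-unjoined crossing representatives (the complement of stmt-4444's event at scale `n`) and the
throughput of every cluster across `B(n) → ∂ⁱⁿB(2n)` is at most `K`, then at most `M·K` edges destroy every open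
crossing of `B(n) → ∂ⁱⁿB(2n)` inside `B(2n)`. (Adapted from the strategist census artefact
`Cruxes/BudgetTightness/AnnulusSplit_s1.lean`.) -/
theorem minCut_le_of_reps_of_throughput {M K n : ℕ} {ω : BondConfig (Site 3)}
    (hM : ¬ ∃ x : Fin (M + 1) → Site 3, (∀ i, x i ∈ box 3 n) ∧
      (∀ i, ∃ y ∈ innerBoundary (zdGraph 3) (box 3 (2 * n)),
        ω ∈ openConnIn (↑(box 3 (2 * n)) : Set (Site 3)) (x i) y) ∧
      ∀ i j, i ≠ j → ω ∉ openConnIn (↑(box 3 (2 * n)) : Set (Site 3)) (x i) (x j))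
    (hK : ∀ x ∈ box 3 n,
      minOpenCutIn (↑(box 3 (2 * n)) : Set (Site 3))
        {a | a ∈ box 3 n ∧ ω ∈ openConnIn (↑(box 3 (2 * n)) : Set (Site 3)) x a}
        (↑(innerBoundary (zdGraph 3) (box 3 (2 * n))) : Set (Site 3)) ω ≤ K) :
    minOpenCutIn (↑(box 3 (2 * n)) : Set (Site 3)) (↑(box 3 n) : Set (Site 3))
      (↑(innerBoundary (zdGraph 3) (box 3 (2 * n))) : Set (Site 3)) ω ≤ ((M * K : ℕ) : ℕ∞) := by
  classical
  -- a pairwise-unjoined family of crossing vertices of `B(n)` of maximal cardinality (chosen in the finite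
  -- set of admissible families, no decidability needed)
  obtain ⟨I, ⟨hIbox, hIcross, hIind⟩, hmax⟩ := Set.exists_max_image
    {J : Finset (Site 3) | (∀ a ∈ J, a ∈ box 3 n) ∧
      (∀ a ∈ J, ∃ y ∈ (↑(innerBoundary (zdGraph 3) (box 3 (2 * n))) : Set (Site 3)),
        ω ∈ openConnIn (↑(box 3 (2 * n)) : Set (Site 3)) a y) ∧
      ∀ a ∈ J, ∀ b ∈ J, a ≠ b → ω ∉ openConnIn (↑(box 3 (2 * n)) : Set (Site 3)) a b}
    Finset.card
    ((box 3 n).powerset.finite_toSet.subset fun J hJ =>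
      Finset.mem_coe.2 (Finset.mem_powerset.2 fun a ha => hJ.1 a ha))
    ⟨∅, fun a ha => absurd ha (Finset.notMem_empty a), fun a ha => absurd ha (Finset.notMem_empty a),
      fun a ha => absurd ha (Finset.notMem_empty a)⟩
  -- (1) at most `M` members, else `M+1` of them witness stmt-4444's event
  have hcard : I.card ≤ M := by
    by_contra hlt
    push Not at hlt
    obtain ⟨J, hJI, hJ⟩ := Finset.exists_subset_card_eq (Nat.succ_le_of_lt hlt)
    have hJcard : Fintype.card {a // a ∈ J} = M + 1 := by rw [Fintype.card_coe]; exact hJ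
    let e : Fin (M + 1) ≃ {a // a ∈ J} := (Fintype.equivFinOfCardEq hJcard).symm
    apply hM
    refine ⟨fun i => ((e i : {a // a ∈ J}) : Site 3), fun i => hIbox _ (hJI (e i).2),
      fun i => ?_, fun i j hij => hIind _ (hJI (e i).2) _ (hJI (e j).2) ?_⟩
    · obtain ⟨y, hy, h⟩ := hIcross _ (hJI (e i).2)
      exact ⟨y, Finset.mem_coe.1 hy, h⟩
    · intro heq
      exact hij (e.injective (Subtype.ext heq))
  -- (2) every crossing vertex of `B(n)` is joined to a member of the family (maximality)
  have hcover : ∀ a ∈ box 3 n,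
      (∃ y ∈ (↑(innerBoundary (zdGraph 3) (box 3 (2 * n))) : Set (Site 3)),
        ω ∈ openConnIn (↑(box 3 (2 * n)) : Set (Site 3)) a y) →
      ∃ x ∈ I, ω ∈ openConnIn (↑(box 3 (2 * n)) : Set (Site 3)) x a := by
    intro a ha hca
    by_contra hno
    push Not at hno
    have haS : a ∈ (↑(box 3 (2 * n)) : Set (Site 3)) := by
      have : box 3 n ⊆ box 3 (2 * n) := box_mono 3 (by omega)
      exact Finset.mem_coe.2 (this ha)
    have haI : a ∉ I := fun h => hno a h (openConnIn_refl haS)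
    have hins : insert a I ∈
        {J : Finset (Site 3) | (∀ a ∈ J, a ∈ box 3 n) ∧
          (∀ a ∈ J, ∃ y ∈ (↑(innerBoundary (zdGraph 3) (box 3 (2 * n))) : Set (Site 3)),
            ω ∈ openConnIn (↑(box 3 (2 * n)) : Set (Site 3)) a y) ∧
          ∀ a ∈ J, ∀ b ∈ J, a ≠ b → ω ∉ openConnIn (↑(box 3 (2 * n)) : Set (Site 3)) a b} := by
      refine ⟨?_, ?_, ?_⟩
      · intro b hb
        rcases Finset.mem_insert.1 hb with rfl | hbI
        · exact ha
        · exact hIbox b hbI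
      · intro b hb
        rcases Finset.mem_insert.1 hb with rfl | hbI
        · exact hca
        · exact hIcross b hbI
      · intro b hb b' hb' hne
        rcases Finset.mem_insert.1 hb with rfl | hbI
        · rcases Finset.mem_insert.1 hb' with rfl | hb'I
          · exact absurd rfl hne
          · exact fun h => hno b' hb'I (by rwa [openConnIn_comm] at h)
        · rcases Finset.mem_insert.1 hb' with rfl | hb'I
          · exact hno b hbI
          · exact hIind b hbI b' hb'I hne
    have := hmax _ hins
    rw [Finset.card_insert_of_notMem haI] at this
    omega
  -- (3) glue the representatives' cutsets
  have hT : ∀ x ∈ I, ∃ T : Finset (Sym2 (Site 3)), T.card ≤ K ∧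
      ¬ ∃ a ∈ {a | a ∈ box 3 n ∧ ω ∈ openConnIn (↑(box 3 (2 * n)) : Set (Site 3)) x a},
        ∃ b ∈ (↑(innerBoundary (zdGraph 3) (box 3 (2 * n))) : Set (Site 3)),
          (ω \ ↑T) ∈ openConnIn (↑(box 3 (2 * n)) : Set (Site 3)) a b :=
    fun x hx => minOpenCutIn_le_iff.1 (hK x (hIbox x hx))
  choose! T hTcard hTcut using hT
  have hcut : ¬ ∃ a ∈ (↑(box 3 n) : Set (Site 3)),
      ∃ b ∈ (↑(innerBoundary (zdGraph 3) (box 3 (2 * n))) : Set (Site 3)),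
        (ω \ ↑(I.biUnion T)) ∈ openConnIn (↑(box 3 (2 * n)) : Set (Site 3)) a b := by
    rintro ⟨a, ha, b, hb, hab⟩
    have ha' : a ∈ box 3 n := Finset.mem_coe.1 ha
    have habω : ω ∈ openConnIn (↑(box 3 (2 * n)) : Set (Site 3)) a b :=
      isUpperSet_openConnIn _ a b Set.sdiff_subset hab
    obtain ⟨x, hxI, hxa⟩ := hcover a ha' ⟨b, hb, habω⟩
    refine hTcut x hxI ⟨a, ⟨ha', hxa⟩, b, hb, ?_⟩
    refine isUpperSet_openConnIn _ a b ?_ hab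
    exact Set.sdiff_subset_sdiff_right (Finset.coe_subset.2 (Finset.subset_biUnion_of_mem T hxI))
  calc minOpenCutIn (↑(box 3 (2 * n)) : Set (Site 3)) (↑(box 3 n) : Set (Site 3))
        (↑(innerBoundary (zdGraph 3) (box 3 (2 * n))) : Set (Site 3)) ω ≤ ((I.biUnion T).card : ℕ∞) :=
        minOpenCutIn_le_iff.2 ⟨I.biUnion T, le_rfl, hcut⟩
    _ ≤ ((M * K : ℕ) : ℕ∞) := by
        have h1 : (I.biUnion T).card ≤ ∑ x ∈ I, (T x).card := Finset.card_biUnion_le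
        have h2 : ∑ x ∈ I, (T x).card ≤ ∑ x ∈ I, K := Finset.sum_le_sum fun x hx => hTcard x hx
        have h3 : ∑ x ∈ I, K = I.card * K := by simp [Finset.sum_const, smul_eq_mul]
        have h4 : I.card * K ≤ M * K := Nat.mul_le_mul_right K hcard
        exact_mod_cast h1.trans (h2.trans (h3.le.trans h4))

end AnnulusSplit

open AnnulusSplit in
/-- **GLUE: `NonProliferation → (per-cluster throughput tight) → BudgetTightness`** with `k = M·K`, `l = 2`
and constant `c/2`. The second hypothesis is the THROUGHPUT half of the strategist's split D2: for every
`ε > 0` there is `K` such that for all large `n`, with probability `≥ 1 - ε` no open cluster of `B(2n)` carries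
more than `K` edge-disjoint open crossings of `B(n) → ∂ⁱⁿB(2n)` (throughput written as the min-cut from the
part of `x`'s cluster inside `B(n)` to `∂ⁱⁿB(2n)`, inside `B(2n)`). Proof: along stmt-4444's subsequence the
event "at most `M` crossing clusters" has probability `≥ c`; eventually the bad-throughput event has
probability `≤ c/2`; on the difference `minCut_le_of_reps_of_throughput` gives `MinCut(n,2n) ≤ M·K`.
(Adapted from `Cruxes/BudgetTightness/AnnulusSplit_s1.lean`, strategist census D2.) -/
theorem budgetTightness_of_nonProliferation_of_throughputTight
    (hNP : NonProliferation)
    (hCT : ∀ ε : ℝ, 0 < ε → ∃ K : ℕ, ∀ᶠ n : ℕ in atTop,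
      (bondPercolation (zdGraph 3) (criticalProbI 3)).real
        {ω | ∃ x ∈ box 3 n, (K : ℕ∞) <
          minOpenCutIn (↑(box 3 (2 * n)) : Set (Site 3))
            {a | a ∈ box 3 n ∧ ω ∈ openConnIn (↑(box 3 (2 * n)) : Set (Site 3)) x a}
            (↑(innerBoundary (zdGraph 3) (box 3 (2 * n))) : Set (Site 3)) ω} ≤ ε) :
    BudgetTightness := by
  obtain ⟨M, c, hc, hfreq⟩ := hNP
  obtain ⟨K, hK⟩ := hCT (c / 2) (by positivity)
  refine ⟨M * K, 2, c / 2, le_rfl, by positivity, fun N => ?_⟩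
  obtain ⟨n, hcn, hNn, hbad⟩ := (hfreq.and_eventually ((eventually_ge_atTop N).and hK)).exists
  refine ⟨n, hNn, ?_⟩
  have hsub :
      {ω : BondConfig (Site 3) | ¬ ∃ x : Fin (M + 1) → Site 3, (∀ i, x i ∈ box 3 n) ∧
        (∀ i, ∃ y ∈ innerBoundary (zdGraph 3) (box 3 (2 * n)),
          ω ∈ openConnIn (↑(box 3 (2 * n)) : Set (Site 3)) (x i) y) ∧
        ∀ i j, i ≠ j → ω ∉ openConnIn (↑(box 3 (2 * n)) : Set (Site 3)) (x i) (x j)} ⊆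
      {ω | ∃ S : Finset (Sym2 (Site 3)), S.card ≤ M * K ∧
        ¬ ∃ x ∈ box 3 n, ∃ y ∈ innerBoundary (zdGraph 3) (box 3 (2 * n)),
          (ω \ ↑S) ∈ openConnIn (↑(box 3 (2 * n)) : Set (Site 3)) x y} ∪
      {ω | ∃ x ∈ box 3 n, (K : ℕ∞) <
          minOpenCutIn (↑(box 3 (2 * n)) : Set (Site 3))
            {a | a ∈ box 3 n ∧ ω ∈ openConnIn (↑(box 3 (2 * n)) : Set (Site 3)) x a}
            (↑(innerBoundary (zdGraph 3) (box 3 (2 * n))) : Set (Site 3)) ω} := by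
    intro ω hω
    by_cases hb : ω ∈ {ω : BondConfig (Site 3) | ∃ x ∈ box 3 n, (K : ℕ∞) <
          minOpenCutIn (↑(box 3 (2 * n)) : Set (Site 3))
            {a | a ∈ box 3 n ∧ ω ∈ openConnIn (↑(box 3 (2 * n)) : Set (Site 3)) x a}
            (↑(innerBoundary (zdGraph 3) (box 3 (2 * n))) : Set (Site 3)) ω}
    · exact Or.inr hb
    · left
      have hK' : ∀ x ∈ box 3 n,
          minOpenCutIn (↑(box 3 (2 * n)) : Set (Site 3))
            {a | a ∈ box 3 n ∧ ω ∈ openConnIn (↑(box 3 (2 * n)) : Set (Site 3)) x a}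
            (↑(innerBoundary (zdGraph 3) (box 3 (2 * n))) : Set (Site 3)) ω ≤ K :=
        fun x hx => not_lt.1 fun h => hb ⟨x, hx, h⟩
      obtain ⟨T, hTcard, hTcut⟩ := minOpenCutIn_le_iff.1 (minCut_le_of_reps_of_throughput hω hK')
      refine ⟨T, hTcard, ?_⟩
      rintro ⟨x, hx, y, hy, hxy⟩
      exact hTcut ⟨x, Finset.mem_coe.2 hx, y, Finset.mem_coe.2 hy, hxy⟩
  have h1 := (measureReal_mono hsub
    (measure_ne_top (bondPercolation (zdGraph 3) (criticalProbI 3)) _)).trans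
    (measureReal_union_le _ _)
  linarith

/-- **Registered stub `stub_annulusSplit` of crux stmt-CriticalPhenomena-5248** (off the composition path of
line Sketch; the strategist census split D2 as one registered implication): stmt-4444's `NonProliferation`
(body verbatim) and uniform tightness of the maximal per-cluster throughput across `B(n) → ∂ⁱⁿB(2n)` at
`p_c(ℤ³)` together give `BudgetTightness`. Proof: `budgetTightness_of_nonProliferation_of_throughputTight`. -/
theorem stub_annulusSplit : (∃ (M : ℕ) (c : ℝ), 0 < c ∧ ∃ᶠ n : ℕ in Filter.atTop, c ≤ (bondPercolation (zdGraph 3) (criticalProbI 3)).real {ω | ¬ ∃ x : Fin (M + 1) → Site 3, (∀ i, x i ∈ box 3 n) ∧ (∀ i, ∃ y ∈ innerBoundary (zdGraph 3) (box 3 (2 * n)), ω ∈ openConnIn (↑(box 3 (2 * n)) : Set (Site 3)) (x i) y) ∧ ∀ i j, i ≠ j → ω ∉ openConnIn (↑(box 3 (2 * n)) : Set (Site 3)) (x i) (x j)}) → (∀ ε : ℝ, 0 < ε → ∃ K : ℕ, ∀ᶠ n : ℕ in Filter.atTop, (bondPercolation (zdGraph 3) (criticalProbI 3)).real {ω | ∃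 x ∈ box 3 n, (K : ℕ∞) < minOpenCutIn (↑(box 3 (2 * n)) : Set (Site 3)) {a | a ∈ box 3 n ∧ ω ∈ openConnIn (↑(box 3 (2 * n)) : Set (Site 3)) x a} (↑(innerBoundary (zdGraph 3) (box 3 (2 * n))) : Set (Site 3)) ω} ≤ ε) → Summit.CriticalPhenomena.PercolationContinuityZ3.Theses.PercBudgetLadder.BudgetTightness :=
  fun hNP hCT => budgetTightness_of_nonProliferation_of_throughputTight hNP hCT

/-- **The throughput half is NECESSARY, in its i.o. form** (appended by lead c10): `BudgetTightness` implies that for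
every `ε > 0` there is `K` such that for infinitely many `n`, with probability `≥ 1 - ε` no open cluster of `B(2n)`
carries more than `K` edge-disjoint open crossings of `B(n) → ∂ⁱⁿB(2n)` — the per-cluster throughput is at most the
annulus min-cut (`minOpenCutIn_mono_left`), whose law is tight along a subsequence (`budgetTightness_iff_tight_two`).
Hence the landed picture `NonProliferation ∧ CTT(eventually) ⟹ BudgetTightness ⟹ NonProliferation ∧ CTT(i.o.)`
(`stub_annulusSplit`, `NonProliferation.nonProliferation_of_budgetTightness_two`, this theorem). -/
theorem throughputTightIO_of_budgetTightness (hBT : BudgetTightness) :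
    ∀ ε : ℝ, 0 < ε → ∃ K : ℕ, ∀ N : ℕ, ∃ n : ℕ, N ≤ n ∧
      (bondPercolation (zdGraph 3) (criticalProbI 3)).real
        {ω | ∃ x ∈ box 3 n, (K : ℕ∞) <
          minOpenCutIn (↑(box 3 (2 * n)) : Set (Site 3))
            {a | a ∈ box 3 n ∧ ω ∈ openConnIn (↑(box 3 (2 * n)) : Set (Site 3)) x a}
            (↑(innerBoundary (zdGraph 3) (box 3 (2 * n))) : Set (Site 3)) ω} ≤ ε := by
  intro ε hε
  by_cases hε1 : 1 ≤ ε
  · exact ⟨0, fun N => ⟨N, le_rfl, measureReal_le_one.trans hε1⟩⟩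
  push Not at hε1
  obtain ⟨k, hk⟩ := (budgetTightness_iff_tight_two.1 hBT) (1 - ε) (by linarith)
  refine ⟨k, fun N => ?_⟩
  obtain ⟨n, hNn, hc⟩ := hk N
  refine ⟨n, hNn, ?_⟩
  -- the tight event is the level set `{MinCut(n,2n) ≤ k}`, which is measurable
  have hev : {ω : BondConfig (Site 3) | ∃ S : Finset (Sym2 (Site 3)), S.card ≤ k ∧
      ¬ ∃ x ∈ box 3 n, ∃ y ∈ innerBoundary (zdGraph 3) (box 3 (2 * n)),
        (ω \ ↑S) ∈ openConnIn (↑(box 3 (2 * n)) : Set (Site 3)) x y} =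
      {ω | minOpenCutIn (↑(box 3 (2 * n)) : Set (Site 3)) (↑(box 3 n) : Set (Site 3))
        (↑(innerBoundary (zdGraph 3) (box 3 (2 * n))) : Set (Site 3)) ω ≤ k} := by
    ext ω
    simp only [Set.mem_setOf_eq, minOpenCutIn_le_iff, Finset.mem_coe]
  have hmeas : MeasurableSet {ω | minOpenCutIn (↑(box 3 (2 * n)) : Set (Site 3)) (↑(box 3 n) : Set (Site 3))
      (↑(innerBoundary (zdGraph 3) (box 3 (2 * n))) : Set (Site 3)) ω ≤ k} :=
    measurableSet_setOf_minOpenCutIn_le (Finset.finite_toSet _) _ _ k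
  rw [hev] at hc
  -- the bad-throughput event lies in the complement of the level set
  have hsub : {ω : BondConfig (Site 3) | ∃ x ∈ box 3 n, (k : ℕ∞) <
          minOpenCutIn (↑(box 3 (2 * n)) : Set (Site 3))
            {a | a ∈ box 3 n ∧ ω ∈ openConnIn (↑(box 3 (2 * n)) : Set (Site 3)) x a}
            (↑(innerBoundary (zdGraph 3) (box 3 (2 * n))) : Set (Site 3)) ω} ⊆
      {ω | minOpenCutIn (↑(box 3 (2 * n)) : Set (Site 3)) (↑(box 3 n) : Set (Site 3))
        (↑(innerBoundary (zdGraph 3) (box 3 (2 * n))) : Set (Site 3)) ω ≤ k}ᶜ := by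
    rintro ω ⟨x, -, hx⟩ hle
    have hmono : minOpenCutIn (↑(box 3 (2 * n)) : Set (Site 3))
        {a | a ∈ box 3 n ∧ ω ∈ openConnIn (↑(box 3 (2 * n)) : Set (Site 3)) x a}
        (↑(innerBoundary (zdGraph 3) (box 3 (2 * n))) : Set (Site 3)) ω ≤
        minOpenCutIn (↑(box 3 (2 * n)) : Set (Site 3)) (↑(box 3 n) : Set (Site 3))
        (↑(innerBoundary (zdGraph 3) (box 3 (2 * n))) : Set (Site 3)) ω :=
      minOpenCutIn_mono_left fun a ha => Finset.mem_coe.2 ha.1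
    exact (lt_irrefl _) ((hx.trans_le hmono).trans_le hle)
  calc (bondPercolation (zdGraph 3) (criticalProbI 3)).real _
      ≤ (bondPercolation (zdGraph 3) (criticalProbI 3)).real
          {ω | minOpenCutIn (↑(box 3 (2 * n)) : Set (Site 3)) (↑(box 3 n) : Set (Site 3))
            (↑(innerBoundary (zdGraph 3) (box 3 (2 * n))) : Set (Site 3)) ω ≤ k}ᶜ :=
        measureReal_mono hsub (measure_ne_top _ _)
    _ = 1 - (bondPercolation (zdGraph 3) (criticalProbI 3)).real
          {ω | minOpenCutIn (↑(box 3 (2 * n)) : Set (Site 3)) (↑(box 3 n) : Set (Site 3))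
            (↑(innerBoundary (zdGraph 3) (box 3 (2 * n))) : Set (Site 3)) ω ≤ k} :=
        probReal_compl_eq_one_sub hmeas
    _ ≤ ε := by linarith

end Summit.CriticalPhenomena.PercolationContinuityZ3.Theorems.BudgetTightness

end
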